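import Summits.HubbardSuperconductivity.HubbardSuperconductivity.Theorems.SoloBlindTwistAveraging
import HarnessLib

/-!
# The d-wave order criterion is not energetically robust

Part 3 of the obstruction lemma (parts 1–2: `SoloBlindGaugeTwist`, `SoloBlindTwistAveraging`). By
`hubbardSuperconductivity_iff_uniform_dWave_bound` (`SoloBlindFiniteVolumeCriterion`) the summit
`HubbardSuperconductivity` asks for `re ⟨φ, Δ_d†Δ_d φ⟩ ≥ c L⁴` for EVERY normalised ground state `φ` of the
doped `S^z = 0` sectors of `hubbardTorus 2 L 1 U`, uniformly in the even side `L`. Combining gauge-twist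
softness with momentum averaging (pigeonhole over the windings `1 … M`):

* `exists_twist_low_energy_small_order` — for `1 ≤ M < L`, every normalised sector ground state `ψ` has a
  twisted copy `φ = W_mᴴψ`, `1 ≤ m ≤ M`, normalised and in the same sector, with
  `re ⟨φ, Hφ⟩ ≤ E₀ + 8π²|t|(M²+M)` and `re ⟨φ, Δ_g†Δ_g φ⟩ ≤ 400 L⁴ / M` (`|g| ≤ 1`);
* `dWave_order_not_energy_robust` — for all `t U : ℝ` and every `c > 0` there are `ε` (namely
  `8π²|t|(M²+M)`, `M = ⌊400/c⌋ + 1`) and `L₀ = M + 3` such that for every side `L ≥ L₀` and every joint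
  sector possessing a ground state `ψ`, some normalised `φ` of the sector with energy within `ε` of the
  ground energy has `re ⟨φ, Δ_d†Δ_d φ⟩ < c L⁴`.

Consequence (the obstruction): any hypothesis on a state that is stable under `L`-independent — a fortiori
`o(L²)` or energy-density-size — perturbations of the energy inside the particle-number / spin sector
(specific ground-state energy, pressure, variational comparison with trial states, Gibbs states at fixed
`β`) is satisfied by states VIOLATING the summit's conclusion; a proof must use the exact eigenvalue
equation (e.g. the momentum quantum number, which `W_m` shifts) or resolve energies below
`ε(c) ≈ 8π²|t|·(400/c)²`.

References: as in parts 1–2 (Bohm 1949; Lieb–Schultz–Mattis 1961; Watanabe, arXiv:1904.02700, §2.2.1,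
§4.1; Tada–Koma, arXiv:1605.06586, Thm. 1; Scalapino, Phys. Rep. 250 (1995) §2). Elementary; [folklore].
-/

noncomputable section

namespace Summit.HubbardSuperconductivity.HubbardSuperconductivity.Theorems

open Matrix Finset Literature.MathematicalPhysics.QuantumLattice
  Literature.MathematicalPhysics.QuantumFieldTheory
open Literature.Probability.LatticeModels (Torus.proj)
open scoped ComplexConjugate

namespace GaugeTwist

variable {L : ℕ} [NeZero L]

/-! ### The energy–order trade-off -/

/-- **Energy–order trade-off for sector ground states** (`L ≥ 3`, `|g| ≤ 1`, `1 ≤ M < L`). For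
every normalised ground state `ψ` of the Hubbard torus in a joint sector `(N, S^z)` with sector
energy `E₀`, one of the `M` twisted copies `W_mᴴψ`, `m = 1, …, M`, is a normalised state OF THE
SAME SECTOR with energy `≤ E₀ + 8π²|t|(M² + M)` and pair-field order
`re ⟨Δ_g† Δ_g⟩ ≤ 400 L⁴ / M`. (Pigeonhole on `sum_twist_pairField_order_le` restricted to the
windings `1, …, M`, combined with `re_twist_energy_le_minEnergyOn_add`.) [folklore] -/
theorem exists_twist_low_energy_small_order (hL : 3 ≤ L) (t U : ℝ) {N : ℕ} {Mz : ℝ}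
    {ψ : Fock (Orb (FermionTorus 2 L))} (hψ : IsGroundStateInSector (hubbardTorus 2 L t U) N Mz ψ)
    (h1 : star ψ ⬝ᵥ ψ = 1) (g : (Fin 2 → ℤ) → ℝ) (hg : ∀ e, |g e| ≤ 1) {M : ℕ} (hM : 1 ≤ M)
    (hML : M < L) :
    ∃ φ ∈ szSector N Mz, star φ ⬝ᵥ φ = 1 ∧
      (star φ ⬝ᵥ (hubbardTorus 2 L t U *ᵥ φ)).re ≤
          (hubbardTorus 2 L t U).minEnergyOn (szSector N Mz) +
            8 * Real.pi ^ 2 * |t| * ((M : ℝ) ^ 2 + M) ∧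
      (expect ((pairField g L)ᴴ * pairField g L) φ).re ≤ 400 * (L : ℝ) ^ 4 / M := by
  classical
  set T : ZMod L → ℝ := fun m => (star (pairField g L *ᵥ ((twistOp m)ᴴ *ᵥ ψ)) ⬝ᵥ
    (pairField g L *ᵥ ((twistOp m)ᴴ *ᵥ ψ))).re with hT
  have hT0 : ∀ m, 0 ≤ T m := fun m => by
    simp only [hT]
    rw [← norm_toLp_sq_eq_re]
    positivity
  have htot : ∑ m : ZMod L, T m ≤ 400 * (L : ℝ) ^ 4 := by
    have := sum_twist_pairField_order_le g hg ψ
    rwa [h1, Complex.one_re, mul_one] at this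
  set S : Finset ℕ := Finset.Icc 1 M with hS
  have hinj : ∀ i ∈ S, ∀ j ∈ S, ((i : ℕ) : ZMod L) = ((j : ℕ) : ZMod L) → i = j := by
    intro i hi j hj hij
    rw [hS, Finset.mem_Icc] at hi hj
    have := (ZMod.natCast_eq_natCast_iff' i j L).1 hij
    rwa [Nat.mod_eq_of_lt (by omega), Nat.mod_eq_of_lt (by omega)] at this
  have hpart : ∑ j ∈ S, T (j : ZMod L) ≤ 400 * (L : ℝ) ^ 4 := by
    rw [← Finset.sum_image hinj]
    exact (Finset.sum_le_sum_of_subset_of_nonneg (Finset.subset_univ _) fun m _ _ => hT0 m).trans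
      htot
  have hSne : S.Nonempty := ⟨1, by rw [hS, Finset.mem_Icc]; omega⟩
  have hM0 : (M : ℝ) ≠ 0 := by exact_mod_cast (show M ≠ 0 by omega)
  obtain ⟨j, hjS, hj⟩ : ∃ j ∈ S, T (j : ZMod L) ≤ 400 * (L : ℝ) ^ 4 / M := by
    apply Finset.exists_le_of_sum_le hSne
    rw [Finset.sum_const, hS, Nat.card_Icc, Nat.add_sub_cancel, nsmul_eq_mul, ← mul_div_assoc,
      mul_div_cancel_left₀ _ hM0]
    exact hpart
  rw [hS, Finset.mem_Icc] at hjS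
  refine ⟨(twistOp (j : ZMod L))ᴴ *ᵥ ψ, twist_mem_szSector _ hψ.1,
    by rw [star_twist_dotProduct_twist, h1], ?_, ?_⟩
  · refine (re_twist_energy_le_minEnergyOn_add hL t U hψ h1 j (Or.inl rfl)).trans ?_
    have hjM : (j : ℝ) ≤ M := by exact_mod_cast hjS.2
    have hj0 : (0 : ℝ) ≤ j := Nat.cast_nonneg j
    have hsq : (j : ℝ) ^ 2 + j ≤ (M : ℝ) ^ 2 + M := by nlinarith
    have := mul_le_mul_of_nonneg_left hsq (by positivity : (0 : ℝ) ≤ 8 * Real.pi ^ 2 * |t|)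
    linarith
  · rw [PosSemidefTrace.expect_conjTranspose_mul]
    exact hj

/-- `|d(e)| ≤ 1` for the `d_{x²-y²}` form factor. [folklore] -/
theorem abs_dWaveFormFactor_le_one (e : Fin 2 → ℤ) : |dWaveFormFactor e| ≤ 1 := by
  unfold dWaveFormFactor
  split_ifs <;> simp

/-- **The ground-state d-wave order criterion is not energetically robust.** For every hopping
`t`, coupling `U` and every order threshold `c > 0` there are an `L`-INDEPENDENT energy `ε` and a
size `L₀` such that on every torus of side `L = n+1 ≥ L₀`, in every joint sector `(N, S^z)`
possessing a ground state, some normalised state of that sector lies within `ε` of the sector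
ground-state energy and has d-wave pair-field order `re ⟨Δ_d† Δ_d⟩ < c L⁴`. By the finite-volume
criterion `hubbardSuperconductivity_iff_uniform_dWave_bound` (this tree), the summit asks exactly
for `re ⟨Δ_d† Δ_d⟩ ≥ c L⁴` on ground states; so no argument whose hypotheses on the state are
invariant under `O(1)` energy perturbations inside the sector (energy-density, pressure,
variational or trial-state methods, whose resolution is at best `o(L²)`) can imply it — a proof
must use the exact eigenvalue equation (or an energy resolution finer than `ε(c) ~ |t|/c²`).
Explicitly `ε = 8π²|t|(M²+M)` with `M = ⌊400/c⌋ + 1`. [folklore] -/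
theorem dWave_order_not_energy_robust (t U c : ℝ) (hc : 0 < c) :
    ∃ ε : ℝ, ∃ L₀ : ℕ, ∀ n : ℕ, L₀ ≤ n + 1 →
      ∀ {N : ℕ} {Mz : ℝ} {ψ : Fock (Orb (FermionTorus 2 (n + 1)))},
        IsGroundStateInSector (hubbardTorus 2 (n + 1) t U) N Mz ψ → star ψ ⬝ᵥ ψ = 1 →
        ∃ φ ∈ szSector N Mz, star φ ⬝ᵥ φ = 1 ∧
          (star φ ⬝ᵥ (hubbardTorus 2 (n + 1) t U *ᵥ φ)).re ≤
              (hubbardTorus 2 (n + 1) t U).minEnergyOn (szSector N Mz) + ε ∧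
          (expect ((pairField dWaveFormFactor (n + 1))ᴴ * pairField dWaveFormFactor (n + 1)) φ).re <
            c * ((n : ℝ) + 1) ^ 4 := by
  set M : ℕ := ⌊400 / c⌋₊ + 1 with hM
  refine ⟨8 * Real.pi ^ 2 * |t| * ((M : ℝ) ^ 2 + M), M + 3, fun n hn N Mz ψ hψ h1 => ?_⟩
  have hM1 : 1 ≤ M := by omega
  have hML : M < n + 1 := by omega
  obtain ⟨φ, hφ, hφ1, hE, hO⟩ := exists_twist_low_energy_small_order (L := n + 1) (by omega) t U hψ
    h1 dWaveFormFactor abs_dWaveFormFactor_le_one hM1 hML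
  refine ⟨φ, hφ, hφ1, hE, hO.trans_lt ?_⟩
  have hcM : 400 / c < M := by rw [hM]; push_cast; exact Nat.lt_floor_add_one _
  have hn4 : (0 : ℝ) < ((n : ℝ) + 1) ^ 4 := by positivity
  have hM0 : (0 : ℝ) < M := by exact_mod_cast hM1
  rw [div_lt_iff₀ hM0]
  rw [div_lt_iff₀ hc] at hcM
  push_cast
  nlinarith [mul_lt_mul_of_pos_right hcM hn4]

end GaugeTwist

end Summit.HubbardSuperconductivity.HubbardSuperconductivity.Theorems
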